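import Literature.NumberTheory.LFunctions.TwistedPrimeSumTail
import Literature.NumberTheory.LFunctions.PretentiousZeta
import Literature.NumberTheory.LFunctions.PretentiousDistanceFord
import HarnessLib

/-!
# Restricted Halász without the polynomial factor, I: clustering of near-aligned twists

Topic `Literature/NumberTheory/LFunctions`.  Everything in this file is PROVED; no definitions, no named facts.

Halász's theorem for block-restricted sums (`Halasz.Restricted.norm_restr_sum_le`, `HalaszRestricted.lean`;
windows: `Halasz.Restricted.norm_restr_interval_sum_le`, `HalaszRestrictedMultWindow.lean`) bounds
`∑_{n ≤ x, n ∈ 𝒮} g(n)` by `K x ((1 + M_½) e^{-M_½} + …)`, `M_½ ≥ M/2` the minimum of the halved distance.  In the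
window `|t - t₁| ≤ (log X)^{1/16}` of Matomäki–Radziwiłł–Tao 2015, Proposition A.3 this yields the middle terms
`(1 + M) e^{-M/2}` (pointwise, `HalaszRestrictedWindow.lean`) or `(1 + M)² e^{-M}` (Gallagher), not the printed
`(1 + M) e^{-M}`.  The factor `(1 + M_½)` is produced by the two-regime `α`-integration of Granville–Soundararajan
(Canad. J. Math. 2003, §4) from the UNIFORM bound `B_w = e⁷ log x · e^{-M_½}` on `Re s = 1` transported to
`Re s = 1 + α` by Poisson smoothing; it is not forced by the problem.  A refined `α`-profile removes it in the
regime `M ≤ c log log x`: a point `(α, y)` is *dangerous* when the off-block distance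
`∑_{p ≤ x, p ∉ E} p^{-α}(1 - Re g(p)p^{-iy})/p` is `< M/2`; non-dangerous points contribute `≪ e^{-M/2}/α`
outright, and the dangerous ones all lie within `e^{O(M)}/log x` of each other (this file), so that they see ONE
frozen block configuration `d*` and Poisson smoothing of the off-block Euler product alone gives the profile
`e^{-d*/2} min(log x · e^{-(M - d*)}, 1/α)`, whose `dα/α`-integral is `≪ log x · e^{-M/2}` with no factor `M`
(part II, `HalaszRestrictedSharp.lean`, to follow).  This first part supplies the two inputs about twists:

* `Halasz.Restricted.Sharp.exists_norm_zeta_le_near_one`, `…exists_norm_zeta_ge_of_away`,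
  `…exists_norm_zeta_ge_near_one` — `1/‖s-1‖ - O(1) ≤ ‖ζ(s)‖ ≤ 1/‖s-1‖ + O(1)` near the pole and
  `‖ζ(σ + it)‖ ≫ min(1/(σ-1), 1/|t|)` on `1 < σ ≤ 2`, `|t| ≤ 1` (the pole `riemannZeta_eq_inv_sub_add` through
  `exists_bound_riemannZeta_sub_inv`, non-vanishing `riemannZeta_ne_zero_of_one_le_re`, compactness);
* `…exists_twistDistSq_ge_log_small`, `…exists_twistDistSq_le_posLog_small`, `…exists_twistDistSq_tail_ge_small` —
  **small twists** `|u| ≤ 1`: `𝔻(1, n^{iu}; x)² = log(|u| log x) + O(1)` from below, `≤ max(0, log(|u| log x)) + O(1)`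
  from above, hence the tail `∑_{w < p ≤ z} (1 - cos(u log p))/p ≥ log min(|u| log z, log z/log w) - O(1)`
  (via `exists_pretentiousDistSq_one_zeta_approx`, `PretentiousZeta.lean`);
* `…sum_twistDist_le_two_mul_add`, `…twistDist_tail_le_two_mul_add` — **transfer**: on any set of primes,
  `𝔻(n^{it}, n^{it₁})² ≤ 2𝔻(g, n^{it})² + 2𝔻(g, n^{it₁})²` (`|g| ≤ 1`; the square of the triangle inequality
  `Halasz.Restricted.sqrt_sum_twistDist_le`);
* `…twist_cluster_of_vk` — **clustering lemma** (from any Vinogradov–Korobov region, `θ > 2/3`): for large `X`,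
  `|t - t₁| ≤ X`, `exp((log X)^θ) ≤ z ≤ X`, `w = exp((log X)^θ) - 1`,
  `min(log(|t - t₁| log z), log log z - θ log log X) ≤ 2A + C`, `A` = the distances of `g` from `n^{it}` and
  `n^{it₁}` carried by the primes of `(w, z]`; the range `|t - t₁| ≥ 1` is the prime number theorem with the
  Vinogradov–Korobov error (`TwistedPrimeSumTail.pretentiousDistSq_one_twist_tail_ge_of_vk`, tree), the range
  `|t - t₁| < 1` the pole of `ζ`;
* `…abs_dampedSummand_sub_le`, `…abs_sum_dampedDist_sub_le` — **block freezing**: the damped block distance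
  `∑_{p ∈ E} p^{-α}(1 - Re g(p) conj p^{iy})/p` moves by `≤ (2|α - α'| + |y - y'|) ∑_{p ∈ E} log p/p` under
  `(α, y) ↦ (α', y')` (`|p^{-α} - p^{-α'}| ≤ |α - α'| log p`, `‖p^{iy} - p^{iy'}‖ ≤ |y - y'| log p`).

## References
* A. Granville, K. Soundararajan, *Decay of mean values of multiplicative functions*, Canad. J. Math. 55 (2003),
  §4 (the `α`-integration) and §10b (`M e^{-M}` is sharp for UNRESTRICTED sums). [cite: GranvilleSoundararajan2003, Theorem 1]
* K. Matomäki, M. Radziwiłł, T. Tao, *An averaged form of Chowla's conjecture*, Algebra & Number Theory 9 (2015),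
  Appendix A, proof of Proposition A.3 (`2𝔻(f, p^{it}) ≥ 𝔻(1, p^{i(t-t₁)}) ≥ (1/√3 - ε)√(log log X)`: the
  repulsion of twists, here localised to a window of primes and extended to `|t - t₁| < 1`).
  [cite: MatomakiRadziwillTao2015, Appendix A, Proposition A.3 (proof)]
* K. Matomäki, M. Radziwiłł, *Multiplicative functions in short intervals II*, arXiv:2007.04290, Lemma 5.3 and the
  Remark after Theorem 9.2 (restricted main terms `2^J M e^{-M/2}`; the question this series addresses).
  [cite: MatomakiRadziwill2020ShortIntervalsII, Lemma 5.3]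

## Design choices
* Constants existential (`∃ x₀ C`, `∃ C, ∀ᶠ X in atTop`), as in `PretentiousZeta.lean` / `TwistedPrimeSumTail.lean`;
  the Vinogradov–Korobov input is any `HasVKZeroFreeRegion cVK TVK` (proved in the tree:
  `VKZeta.exists_hasVKZeroFreeRegion`).
* Twists are `fun n : ℕ => (n : ℂ) ^ ((t : ℂ) * I)` and distances `Sieve.pretentiousDistSq`, tails as differences
  of distances at two heights (no new definitions); the damped block distance is written as the explicit sum.
-/

noncomputable section

open Finset Real Complex Filter
open scoped ComplexConjugate

namespace Literature.NumberTheory.LFunctions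

namespace Halasz.Restricted.Sharp

open Literature.NumberTheory.Sieve (pretentiousDistSq)

/-! ### `ζ` near `s = 1`: two-sided bounds on `1 < σ ≤ 2`, `|t| ≤ 1` -/

/-- **Upper bound near the pole**: `‖ζ(s)‖ ≤ 1/‖s - 1‖ + M` on `[1,2] × [-2,2]`, `s ≠ 1`. [folklore] -/
theorem exists_norm_zeta_le_near_one :
    ∃ M : ℝ, 0 ≤ M ∧ ∀ s : ℂ, 1 ≤ s.re → s.re ≤ 2 → |s.im| ≤ 2 → s ≠ 1 →
      ‖riemannZeta s‖ ≤ 1 / ‖s - 1‖ + M := by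
  obtain ⟨M, hM0, hM⟩ := exists_bound_riemannZeta_sub_inv
  refine ⟨M, hM0, fun s h1 h2 h3 hs => ?_⟩
  have h := hM s h1 h2 h3 hs
  calc ‖riemannZeta s‖ = ‖(s - 1)⁻¹ + (riemannZeta s - (s - 1)⁻¹)‖ := by ring_nf
    _ ≤ ‖(s - 1)⁻¹‖ + ‖riemannZeta s - (s - 1)⁻¹‖ := norm_add_le _ _
    _ ≤ 1 / ‖s - 1‖ + M := by rw [norm_inv, one_div]; gcongr

/-- **`ζ` is bounded away from `0` on `[1,2] × [-1,1]` away from the pole**: for every `r > 0` there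
is `c > 0` with `‖ζ(s)‖ ≥ c` whenever `1 ≤ Re s ≤ 2`, `|Im s| ≤ 1`, `‖s - 1‖ ≥ r`
(non-vanishing on `Re s ≥ 1`, continuity, compactness). [folklore] -/
theorem exists_norm_zeta_ge_of_away {r : ℝ} (hr : 0 < r) :
    ∃ c : ℝ, 0 < c ∧ ∀ s : ℂ, 1 ≤ s.re → s.re ≤ 2 → |s.im| ≤ 1 → r ≤ ‖s - 1‖ →
      c ≤ ‖riemannZeta s‖ := by
  set K : Set ℂ := ((fun p : ℝ × ℝ => (p.1 : ℂ) + p.2 * I) '' (Set.Icc 1 2 ×ˢ Set.Icc (-1) 1)) ∩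
    {s : ℂ | r ≤ ‖s - 1‖} with hK
  have hKc : IsCompact K := by
    refine IsCompact.inter_right (IsCompact.image (isCompact_Icc.prod isCompact_Icc) (by fun_prop)) ?_
    exact isClosed_le continuous_const (by fun_prop)
  have hK1 : ∀ s ∈ K, s ≠ 1 := by
    rintro s ⟨-, hs⟩ h
    simp only [Set.mem_setOf_eq, h, sub_self, norm_zero] at hs
    linarith
  have hKre : ∀ s ∈ K, 1 ≤ s.re := by
    rintro s ⟨⟨p, hp, rfl⟩, -⟩
    simpa using hp.1.1
  have hcont : ContinuousOn (fun s => ‖riemannZeta s‖) K := fun s hs =>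
    ((differentiableAt_riemannZeta (hK1 s hs)).continuousAt.norm).continuousWithinAt
  by_cases hne : K.Nonempty
  · obtain ⟨s₀, hs₀, hmin⟩ := hKc.exists_isMinOn hne hcont
    have hpos : 0 < ‖riemannZeta s₀‖ := norm_pos_iff.mpr (riemannZeta_ne_zero_of_one_le_re (hKre s₀ hs₀))
    refine ⟨‖riemannZeta s₀‖, hpos, fun s h1 h2 h3 h4 => ?_⟩
    have hsK : s ∈ K := by
      refine ⟨⟨(s.re, s.im), ⟨⟨h1, h2⟩, abs_le.1 h3⟩, ?_⟩, h4⟩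
      simp
    exact hmin hsK
  · refine ⟨1, one_pos, fun s h1 h2 h3 h4 => ?_⟩
    exfalso; apply hne
    refine ⟨s, ⟨(s.re, s.im), ⟨⟨h1, h2⟩, abs_le.1 h3⟩, ?_⟩, h4⟩
    simp

/-- **Lower bound near the pole**: there is `c > 0` with
`‖ζ(σ + it)‖ ≥ c · min(1/(σ - 1), 1/|t|)` for `1 < σ ≤ 2`, `0 < |t| ≤ 1`, and `‖ζ(σ + it)‖ ≥ c/(σ - 1)`
when `t = 0` — stated as `c · min (1/(σ-1)) (1/|t|) ≤ ‖ζ‖` with the convention `1/0 = 0` harmlessly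
avoided by `hmin`. [folklore] -/
theorem exists_norm_zeta_ge_near_one :
    ∃ c : ℝ, 0 < c ∧ ∀ σ t m : ℝ, 1 < σ → σ ≤ 2 → |t| ≤ 1 → 0 < m → m * (σ - 1) ≤ 1 → m * |t| ≤ 1 →
      c * m ≤ ‖riemannZeta (σ + t * I)‖ := by
  obtain ⟨M, hM0, hM⟩ := exists_bound_riemannZeta_sub_inv
  -- away from the pole
  set r : ℝ := 1 / (4 * (M + 1)) with hr
  have hr0 : 0 < r := by positivity
  obtain ⟨c₀, hc₀, hfar⟩ := exists_norm_zeta_ge_of_away hr0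
  refine ⟨min (1 / 4) (c₀ * r / 2), by positivity, fun σ t m hσ1 hσ2 ht hm hmσ hmt => ?_⟩
  set s : ℂ := σ + t * I with hs
  have hsre : s.re = σ := by simp [hs]
  have hsim : s.im = t := by simp [hs]
  have hs1 : s ≠ 1 := by
    intro h; have := congrArg Complex.re h; rw [hsre] at this; simp at this; linarith
  have hsub : s - 1 = ((σ - 1 : ℝ) : ℂ) + t * I := by simp [hs]; ring
  -- `‖s - 1‖ ≤ (σ - 1) + |t| ≤ 2/m`
  have hnorm_le : ‖s - 1‖ ≤ (σ - 1) + |t| := by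
    rw [hsub]
    calc ‖((σ - 1 : ℝ) : ℂ) + t * I‖ ≤ ‖((σ - 1 : ℝ) : ℂ)‖ + ‖(t : ℂ) * I‖ := norm_add_le _ _
      _ = (σ - 1) + |t| := by
          rw [Complex.norm_real, norm_mul, Complex.norm_I, mul_one, Complex.norm_real,
            Real.norm_eq_abs, Real.norm_eq_abs, abs_of_pos (by linarith)]
  have hnorm_pos : 0 < ‖s - 1‖ := norm_pos_iff.mpr (sub_ne_zero.mpr hs1)
  have h2m : ‖s - 1‖ ≤ 2 / m := by
    have h1 : σ - 1 ≤ 1 / m := by rw [le_div_iff₀ hm]; linarith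
    have h2 : |t| ≤ 1 / m := by rw [le_div_iff₀ hm]; linarith
    calc ‖s - 1‖ ≤ (σ - 1) + |t| := hnorm_le
      _ ≤ 1 / m + 1 / m := add_le_add h1 h2
      _ = 2 / m := by ring
  rcases le_or_gt r ‖s - 1‖ with hcase | hcase
  · -- far from the pole: `‖ζ‖ ≥ c₀`, and `m ≤ 2/‖s-1‖ ≤ 2/r`
    have hζ := hfar s (by rw [hsre]; linarith) (by rw [hsre]; linarith) (by rw [hsim]; exact ht) hcase
    have hm_le : m ≤ 2 / r := by
      rw [le_div_iff₀ hr0]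
      have := (le_div_iff₀ hm).1 h2m
      nlinarith
    calc min (1 / 4) (c₀ * r / 2) * m ≤ (c₀ * r / 2) * m :=
          mul_le_mul_of_nonneg_right (min_le_right _ _) hm.le
      _ ≤ (c₀ * r / 2) * (2 / r) := by gcongr
      _ = c₀ := by field_simp
      _ ≤ ‖riemannZeta s‖ := hζ
  · -- near the pole: `‖ζ‖ ≥ 1/‖s-1‖ - M ≥ m/2 - M ≥ m/4` since `m ≥ ... `
    have hζ := hM s (by rw [hsre]; linarith) (by rw [hsre]; linarith)
      (by rw [hsim]; linarith [abs_nonneg t]) hs1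
    have hlow : 1 / ‖s - 1‖ - M ≤ ‖riemannZeta s‖ := by
      have h1 : ‖(s - 1)⁻¹‖ - ‖riemannZeta s - (s - 1)⁻¹‖ ≤ ‖riemannZeta s‖ := by
        have := norm_sub_norm_le (s - 1)⁻¹ ((s - 1)⁻¹ - riemannZeta s)
        rw [sub_sub_cancel, norm_sub_rev] at this
        linarith
      rw [norm_inv, ← one_div] at h1
      linarith
    -- `1/‖s-1‖ > 1/r = 4(M+1)` so `M ≤ (1/‖s-1‖)/4`, and `1/‖s-1‖ ≥ m/2`
    have hinv_gt : 4 * (M + 1) < 1 / ‖s - 1‖ := by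
      rw [lt_div_iff₀ hnorm_pos]
      have : ‖s - 1‖ * (4 * (M + 1)) < r * (4 * (M + 1)) := by nlinarith
      rw [hr] at this
      field_simp at this
      nlinarith
    have hinv_ge : m / 2 ≤ 1 / ‖s - 1‖ := by
      rw [div_le_div_iff₀ (by norm_num) hnorm_pos]
      have := (le_div_iff₀ hm).1 h2m
      nlinarith
    calc min (1 / 4) (c₀ * r / 2) * m ≤ (1 / 4) * m :=
          mul_le_mul_of_nonneg_right (min_le_left _ _) hm.le
      _ ≤ 1 / ‖s - 1‖ - M := by nlinarith
      _ ≤ ‖riemannZeta s‖ := hlow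

/-! ### The distance `𝔻(1, n^{iu}; x)²` for small twists `|u| ≤ 1` -/

/-- `𝔻(1, n^{iu}; x)² ≥ 0`. [folklore] -/
theorem twistDistSq_nonneg (u x : ℝ) :
    0 ≤ pretentiousDistSq 1 (fun n : ℕ => (n : ℂ) ^ ((u : ℂ) * I)) x :=
  Sieve.pretentiousDistSq_nonneg (fun n => by simp) (Halasz.Restricted.norm_natCast_cpow_le_one_of_re_eq_zero (by simp)) x

/-- **Small twists, lower bound**: there are `x₀, C` with
`𝔻(1, n^{iu}; x)² ≥ log(|u| log x) - C` for `x ≥ x₀`, `|u| ≤ 1`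
(`𝔻² = log log x - log|ζ(σ_x - iu)| + O(1)` and `|ζ(σ_x - iu)| ≤ 1/|u| + O(1)`). [folklore] -/
theorem exists_twistDistSq_ge_log_small :
    ∃ x₀ C : ℝ, 3 ≤ x₀ ∧ 0 ≤ C ∧ ∀ x : ℝ, x₀ ≤ x → ∀ u : ℝ, |u| ≤ 1 →
      Real.log (|u| * Real.log x) - C ≤ pretentiousDistSq 1 (fun n : ℕ => (n : ℂ) ^ ((u : ℂ) * I)) x := by
  obtain ⟨x₁, C₁, hx₁, hD⟩ := exists_pretentiousDistSq_one_zeta_approx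
  obtain ⟨M, hM0, hM⟩ := exists_norm_zeta_le_near_one
  have hC₁ : 0 ≤ C₁ := le_trans (abs_nonneg _) (hD x₁ le_rfl 0)
  have hlogM : 0 ≤ Real.log (1 + M) := Real.log_nonneg (by linarith)
  refine ⟨max x₁ (Real.exp 1), C₁ + Real.log (1 + M), le_trans hx₁ (le_max_left _ _),
    by positivity, fun x hx u hu => ?_⟩
  have hx1 : x₁ ≤ x := le_trans (le_max_left _ _) hx
  have hxe : Real.exp 1 ≤ x := le_trans (le_max_right _ _) hx
  have hx1' : (1 : ℝ) < x := by linarith [hx₁]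
  have hlog1 : 1 ≤ Real.log x := one_le_log_of_exp_le hxe
  have hD' := hD x hx1 u
  rw [PretentiousFord.twistedChar_one] at hD'
  have hD2 := (abs_le.1 hD').1
  -- the case `u = 0` is trivial
  rcases eq_or_ne u 0 with rfl | hu0
  · simp only [abs_zero, zero_mul, Real.log_zero, zero_sub]
    linarith [twistDistSq_nonneg 0 x, Real.log_nonneg (by linarith : (1 : ℝ) ≤ 1 + M)]
  have hu0' : 0 < |u| := abs_pos.mpr hu0
  -- `‖ζ(σ_x - iu)‖ ≤ 1/|u| + M ≤ (1 + M)/|u|`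
  set s : ℂ := (sigmaX x : ℂ) - u * I with hs
  have hsre : s.re = sigmaX x := by simp [hs]
  have hsim : s.im = -u := by simp [hs]
  have hσ1 := one_lt_sigmaX hx1'
  have hσ2 := sigmaX_le_two hxe
  have hs1 : s ≠ 1 := by
    intro h; have := congrArg Complex.re h; rw [hsre] at this; simp at this; linarith
  have hsub_norm : |u| ≤ ‖s - 1‖ := by
    have := Complex.abs_im_le_norm (s - 1)
    simpa [hsim] using this
  have hζle : ‖riemannZeta s‖ ≤ (1 + M) / |u| := by
    have h := hM s (by rw [hsre]; exact hσ1.le) (by rw [hsre]; exact hσ2)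
      (by rw [hsim, abs_neg]; linarith) hs1
    calc ‖riemannZeta s‖ ≤ 1 / ‖s - 1‖ + M := h
      _ ≤ 1 / |u| + M := by gcongr
      _ ≤ 1 / |u| + M / |u| := by
          gcongr
          rw [le_div_iff₀ hu0']
          nlinarith
      _ = (1 + M) / |u| := by ring
  have hζpos : 0 < ‖riemannZeta s‖ :=
    norm_pos_iff.mpr (riemannZeta_ne_zero_of_one_le_re (by rw [hsre]; exact hσ1.le))
  have hlogζ : Real.log ‖riemannZeta s‖ ≤ Real.log (1 + M) - Real.log |u| := by
    have := Real.log_le_log hζpos hζle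
    rwa [Real.log_div (by linarith) hu0'.ne'] at this
  have hlogmul : Real.log (|u| * Real.log x) = Real.log |u| + Real.log (Real.log x) :=
    Real.log_mul hu0'.ne' (by linarith)
  rw [hlogmul]
  linarith

/-- **Small twists, upper bound**: there are `x₀, C` with
`𝔻(1, n^{iu}; x)² ≤ max(0, log(|u| log x)) + C` for `x ≥ x₀`, `|u| ≤ 1`
(`|ζ(σ_x - iu)| ≫ min(log x, 1/|u|)`: the pole, and non-vanishing on `Re s ≥ 1`). [folklore] -/
theorem exists_twistDistSq_le_posLog_small :
    ∃ x₀ C : ℝ, 3 ≤ x₀ ∧ 0 ≤ C ∧ ∀ x : ℝ, x₀ ≤ x → ∀ u : ℝ, |u| ≤ 1 →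
      pretentiousDistSq 1 (fun n : ℕ => (n : ℂ) ^ ((u : ℂ) * I)) x ≤
        max 0 (Real.log (|u| * Real.log x)) + C := by
  obtain ⟨x₁, C₁, hx₁, hD⟩ := exists_pretentiousDistSq_one_zeta_approx
  obtain ⟨c, hc, hζ⟩ := exists_norm_zeta_ge_near_one
  have hC₁ : 0 ≤ C₁ := le_trans (abs_nonneg _) (hD x₁ le_rfl 0)
  refine ⟨max x₁ (Real.exp 1), C₁ + |Real.log c|, le_trans hx₁ (le_max_left _ _), by positivity,
    fun x hx u hu => ?_⟩
  have hx1 : x₁ ≤ x := le_trans (le_max_left _ _) hx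
  have hxe : Real.exp 1 ≤ x := le_trans (le_max_right _ _) hx
  have hx1' : (1 : ℝ) < x := by linarith [hx₁]
  have hlog1 : 1 ≤ Real.log x := one_le_log_of_exp_le hxe
  have hlogpos : 0 < Real.log x := by linarith
  have hD' := hD x hx1 u
  rw [PretentiousFord.twistedChar_one] at hD'
  have hD2 := (abs_le.1 hD').2
  have hσ1 := one_lt_sigmaX hx1'
  have hσ2 := sigmaX_le_two hxe
  have hσsub : sigmaX x - 1 = 1 / Real.log x := by unfold sigmaX; ring
  -- `m = min(log x, 1/|u|)` handled by cases on `|u| log x ≤ 1`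
  have hs_eq : (sigmaX x : ℂ) - u * I = (sigmaX x : ℂ) + ((-u : ℝ) : ℂ) * I := by push_cast; ring
  rcases le_or_gt (|u| * Real.log x) 1 with hcase | hcase
  · -- `m = log x`
    have hm := hζ (sigmaX x) (-u) (Real.log x) hσ1 hσ2 (by rw [abs_neg]; exact hu) hlogpos
      (by rw [hσsub]; field_simp; rfl) (by rw [abs_neg, mul_comm]; exact hcase)
    rw [← hs_eq] at hm
    have hpos : 0 < c * Real.log x := by positivity
    have hlogζ : Real.log c + Real.log (Real.log x) ≤
        Real.log ‖riemannZeta ((sigmaX x : ℂ) - u * I)‖ := by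
      rw [← Real.log_mul hc.ne' hlogpos.ne']
      exact Real.log_le_log hpos hm
    have : Real.log c ≥ -|Real.log c| := neg_abs_le _
    linarith [le_max_left 0 (Real.log (|u| * Real.log x))]
  · -- `m = 1/|u|`
    have hu0' : 0 < |u| := by
      rcases eq_or_ne u 0 with rfl | h
      · simp at hcase; linarith
      · exact abs_pos.mpr h
    have hm := hζ (sigmaX x) (-u) (1 / |u|) hσ1 hσ2 (by rw [abs_neg]; exact hu) (by positivity)
      (by rw [hσsub, div_mul_div_comm, one_mul, div_le_one (by positivity)]; linarith)
      (by rw [abs_neg]; field_simp; rfl)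
    rw [← hs_eq] at hm
    have hpos : 0 < c * (1 / |u|) := by positivity
    have hlogζ : Real.log c - Real.log |u| ≤ Real.log ‖riemannZeta ((sigmaX x : ℂ) - u * I)‖ := by
      have h := Real.log_le_log hpos hm
      rwa [Real.log_mul hc.ne' (by positivity), one_div, Real.log_inv] at h
    have hlogmul : Real.log (|u| * Real.log x) = Real.log |u| + Real.log (Real.log x) :=
      Real.log_mul hu0'.ne' hlogpos.ne'
    have : Real.log c ≥ -|Real.log c| := neg_abs_le _
    have hmax : Real.log (|u| * Real.log x) ≤ max 0 (Real.log (|u| * Real.log x)) := le_max_right _ _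
    linarith

/-- **Small twists, the tail**: there are `x₀, C` with
`𝔻(1, n^{iu}; z)² - 𝔻(1, n^{iu}; w)² ≥ log(|u| log z) - max(0, log(|u| log w)) - C`
for `x₀ ≤ w ≤ z`, `|u| ≤ 1`; i.e. the sum of `(1 - cos(u log p))/p` over `w < p ≤ z` is
`≥ log min(|u| log z, log z/log w) - C`. [folklore] -/
theorem exists_twistDistSq_tail_ge_small :
    ∃ x₀ C : ℝ, 3 ≤ x₀ ∧ 0 ≤ C ∧ ∀ w z : ℝ, x₀ ≤ w → w ≤ z → ∀ u : ℝ, |u| ≤ 1 →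
      Real.log (|u| * Real.log z) - max 0 (Real.log (|u| * Real.log w)) - C ≤
        pretentiousDistSq 1 (fun n : ℕ => (n : ℂ) ^ ((u : ℂ) * I)) z -
          pretentiousDistSq 1 (fun n : ℕ => (n : ℂ) ^ ((u : ℂ) * I)) w := by
  obtain ⟨x₁, C₁, hx₁, hC₁, h1⟩ := exists_twistDistSq_ge_log_small
  obtain ⟨x₂, C₂, hx₂, hC₂, h2⟩ := exists_twistDistSq_le_posLog_small
  refine ⟨max x₁ x₂, C₁ + C₂, le_trans hx₁ (le_max_left _ _), by positivity,
    fun w z hw hwz u hu => ?_⟩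
  have hz := h1 z (le_trans (le_max_left _ _) (hw.trans hwz)) u hu
  have hw' := h2 w (le_trans (le_max_right _ _) hw) u hu
  linarith

/-! ### Transfer: two twists near `g` on a set of primes are near each other there -/

/-- `𝔻_O(n^{it}, n^{it₁})² ≤ 2 𝔻_O(g, n^{it})² + 2 𝔻_O(g, n^{it₁})²` over any finite set `O` of indices, for
`|g| ≤ 1` — the square of the triangle inequality `√d ≤ √a + √b` (`sqrt_sum_twistDist_le`). [folklore] -/
theorem sum_twistDist_le_two_mul_add {g : ℕ → ℂ} (hgb : ∀ n, ‖g n‖ ≤ 1) (O : Finset ℕ) (t t₁ : ℝ) :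
    ∑ p ∈ O, (1 - ((p : ℂ) ^ ((t : ℂ) * I) * conj ((p : ℂ) ^ ((t₁ : ℂ) * I))).re) / p ≤
      2 * ∑ p ∈ O, (1 - (g p * conj ((p : ℂ) ^ ((t : ℂ) * I))).re) / p +
        2 * ∑ p ∈ O, (1 - (g p * conj ((p : ℂ) ^ ((t₁ : ℂ) * I))).re) / p := by
  have h := Halasz.Restricted.sqrt_sum_twistDist_le hgb O t t₁
  set d := ∑ p ∈ O, (1 - ((p : ℂ) ^ ((t : ℂ) * I) * conj ((p : ℂ) ^ ((t₁ : ℂ) * I))).re) / p with hd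
  set a := ∑ p ∈ O, (1 - (g p * conj ((p : ℂ) ^ ((t : ℂ) * I))).re) / p with ha
  set b := ∑ p ∈ O, (1 - (g p * conj ((p : ℂ) ^ ((t₁ : ℂ) * I))).re) / p with hb
  have hd0 : 0 ≤ d := Finset.sum_nonneg fun p _ =>
    Sieve.pretentiousDistSq_summand_nonneg (Halasz.Restricted.norm_natCast_cpow_le_one_of_re_eq_zero (by simp))
      (Halasz.Restricted.norm_natCast_cpow_le_one_of_re_eq_zero (by simp)) p
  have ha0 : 0 ≤ a := Finset.sum_nonneg fun p _ =>
    Sieve.pretentiousDistSq_summand_nonneg hgb (Halasz.Restricted.norm_natCast_cpow_le_one_of_re_eq_zero (by simp)) p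
  have hb0 : 0 ≤ b := Finset.sum_nonneg fun p _ =>
    Sieve.pretentiousDistSq_summand_nonneg hgb (Halasz.Restricted.norm_natCast_cpow_le_one_of_re_eq_zero (by simp)) p
  have hsq : d ≤ (Real.sqrt a + Real.sqrt b) ^ 2 := by
    calc d = (Real.sqrt d) ^ 2 := (Real.sq_sqrt hd0).symm
      _ ≤ (Real.sqrt a + Real.sqrt b) ^ 2 := by
          gcongr
  have hexp : (Real.sqrt a + Real.sqrt b) ^ 2 ≤ 2 * a + 2 * b := by
    have h1 := Real.sq_sqrt ha0
    have h2 := Real.sq_sqrt hb0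
    nlinarith [sq_nonneg (Real.sqrt a - Real.sqrt b)]
  linarith

/-- The tail of a distance: for `1`-bounded `a, b` and `w ≤ z`,
`𝔻(a, b; z)² - 𝔻(a, b; w)² = ∑_{p ∈ P_z ∖ P_w} (1 - Re(a(p) conj b(p)))/p` (`P_x` = primes `≤ ⌊x⌋`). [folklore] -/
theorem pretentiousDistSq_sub_eq_sum_sdiff (a b : ℕ → ℂ) {w z : ℝ} (hwz : w ≤ z) :
    pretentiousDistSq a b z - pretentiousDistSq a b w =
      ∑ p ∈ Nat.primesLE ⌊z⌋₊ \ Nat.primesLE ⌊w⌋₊, (1 - (a p * conj (b p)).re) / p := by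
  have hsub : Nat.primesLE ⌊w⌋₊ ⊆ Nat.primesLE ⌊z⌋₊ := by
    intro p hp
    rw [Nat.mem_primesLE] at hp ⊢
    exact ⟨hp.1.trans (Nat.floor_le_floor hwz), hp.2⟩
  unfold pretentiousDistSq
  rw [← Finset.sum_sdiff hsub, add_sub_cancel_right]

/-- **Transfer on a tail**: for `|g| ≤ 1` and `w ≤ z`,
`𝔻(1, n^{i(t-t₁)}; z)² - 𝔻(1, n^{i(t-t₁)}; w)² ≤ 2 (𝔻(g, n^{it}; z)² - 𝔻(g, n^{it}; w)²) + 2 (𝔻(g, n^{it₁}; z)² - 𝔻(g, n^{it₁}; w)²)`.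
[folklore] -/
theorem twistDist_tail_le_two_mul_add {g : ℕ → ℂ} (hgb : ∀ n, ‖g n‖ ≤ 1) {w z : ℝ} (hwz : w ≤ z)
    (t t₁ : ℝ) :
    pretentiousDistSq 1 (fun n : ℕ => (n : ℂ) ^ (((t - t₁ : ℝ) : ℂ) * I)) z -
        pretentiousDistSq 1 (fun n : ℕ => (n : ℂ) ^ (((t - t₁ : ℝ) : ℂ) * I)) w ≤
      2 * (pretentiousDistSq g (fun n : ℕ => (n : ℂ) ^ ((t : ℂ) * I)) z -
            pretentiousDistSq g (fun n : ℕ => (n : ℂ) ^ ((t : ℂ) * I)) w) +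
        2 * (pretentiousDistSq g (fun n : ℕ => (n : ℂ) ^ ((t₁ : ℂ) * I)) z -
            pretentiousDistSq g (fun n : ℕ => (n : ℂ) ^ ((t₁ : ℂ) * I)) w) := by
  rw [← Halasz.Restricted.pretentiousDistSq_twist_twist t t₁ z,
    ← Halasz.Restricted.pretentiousDistSq_twist_twist t t₁ w, pretentiousDistSq_sub_eq_sum_sdiff _ _ hwz,
    pretentiousDistSq_sub_eq_sum_sdiff _ _ hwz, pretentiousDistSq_sub_eq_sum_sdiff _ _ hwz]
  exact sum_twistDist_le_two_mul_add hgb _ t t₁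

/-! ### Clustering of near-aligned twists -/

/-- **Clustering lemma** (from any Vinogradov–Korobov region `HasVKZeroFreeRegion cVK TVK`, `cVK > 0`; `θ > 2/3`).
There is `C ≥ 0` such that for all large `X`, every `g` with `|g| ≤ 1`, all `t, t₁` with `|t - t₁| ≤ X` and all
`exp((log X)^θ) ≤ z ≤ X`, writing `w = exp((log X)^θ) - 1` and
`A = (𝔻(g, n^{it}; z)² - 𝔻(g, n^{it}; w)²) + (𝔻(g, n^{it₁}; z)² - 𝔻(g, n^{it₁}; w)²)` (the distances of `g` from the
two twists carried by the primes of `(w, z]`):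

  `min( log(|t - t₁| log z), log log z - θ log log X ) ≤ 2A + C`.

So if `g` is close to both `n^{it}` and `n^{it₁}` on the large primes (`2A + C < log log z - θ log log X`) then
`|t - t₁| ≤ e^{2A + C}/log z`: near-aligned twists cluster at scale `1/log z`.  Proof: the transfer inequality
(`twistDist_tail_le_two_mul_add`) bounds the tail of `𝔻(1, n^{i(t-t₁)})²` by `2A`; that tail is
`≥ log log z - θ log log X - 6` for `|t - t₁| ≥ 1` (prime number theorem with the Vinogradov–Korobov error,
`TwistedPrimeSumTail.pretentiousDistSq_one_twist_tail_ge_of_vk`) and `≥ log(|t-t₁| log z) - max(0, log(|t-t₁| log w)) - C`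
for `|t - t₁| < 1` (the pole of `ζ`, `exists_twistDistSq_tail_ge_small`).  (Granville–Soundararajan's
"repulsion" principle `𝔻(f, n^{it}) + 𝔻(f, n^{it₁}) ≥ 𝔻(n^{it}, n^{it₁})`, localised to a window of primes.)
[cite: MatomakiRadziwillTao2015, Appendix A, Proposition A.3 (proof)] [cite: GranvilleSoundararajan2003, Theorem 1] -/
theorem twist_cluster_of_vk {cVK TVK : ℝ} (hcVK : 0 < cVK) (hVK : HasVKZeroFreeRegion cVK TVK)
    {θ : ℝ} (hθ : 2 / 3 < θ) :
    ∃ C : ℝ, 0 ≤ C ∧ ∀ᶠ X : ℝ in atTop, ∀ g : ℕ → ℂ, (∀ n, ‖g n‖ ≤ 1) → ∀ t t₁ z : ℝ,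
      |t - t₁| ≤ X → Real.exp (Real.log X ^ θ) ≤ z → z ≤ X →
      min (Real.log (|t - t₁| * Real.log z)) (Real.log (Real.log z) - θ * Real.log (Real.log X)) ≤
        2 * ((pretentiousDistSq g (fun n : ℕ => (n : ℂ) ^ ((t : ℂ) * I)) z -
              pretentiousDistSq g (fun n : ℕ => (n : ℂ) ^ ((t : ℂ) * I)) (Real.exp (Real.log X ^ θ) - 1)) +
            (pretentiousDistSq g (fun n : ℕ => (n : ℂ) ^ ((t₁ : ℂ) * I)) z -
              pretentiousDistSq g (fun n : ℕ => (n : ℂ) ^ ((t₁ : ℂ) * I)) (Real.exp (Real.log X ^ θ) - 1))) + C := by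
  obtain ⟨x₀, Cs, hx₀, hCs, hsmall⟩ := exists_twistDistSq_tail_ge_small
  have hθ0 : 0 < θ := by linarith
  refine ⟨Cs + 6, by positivity, ?_⟩
  filter_upwards [TwistedPrimeSumTail.pretentiousDistSq_one_twist_tail_ge_of_vk hcVK hVK hθ,
    ((tendsto_rpow_atTop hθ0).comp Real.tendsto_log_atTop).eventually_ge_atTop (Real.log (x₀ + 1)),
    Real.tendsto_log_atTop.eventually_ge_atTop (1 : ℝ)] with X hVKX hℓθ hℓ1
  intro g hgb t t₁ z htX hz hzX
  set ℓ : ℝ := Real.log X with hℓ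
  have hℓθ' : Real.log (x₀ + 1) ≤ ℓ ^ θ := by simpa using hℓθ
  set w : ℝ := Real.exp (ℓ ^ θ) - 1 with hw
  have hw0 : x₀ ≤ w := by
    have : x₀ + 1 ≤ Real.exp (ℓ ^ θ) := by
      rw [← Real.exp_log (by linarith : (0 : ℝ) < x₀ + 1)]
      exact Real.exp_le_exp.2 hℓθ'
    rw [hw]; linarith
  have hw3 : 3 ≤ w := hx₀.trans hw0
  have hwz : w ≤ z := by rw [hw]; linarith
  have hlogw_pos : 0 < Real.log w := Real.log_pos (by linarith)
  have hlogw_le : Real.log w ≤ ℓ ^ θ := by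
    calc Real.log w ≤ Real.log (Real.exp (ℓ ^ θ)) :=
          Real.log_le_log (by linarith) (by rw [hw]; linarith)
      _ = ℓ ^ θ := Real.log_exp _
  have hℓ0 : 0 < ℓ := by linarith
  have hloglogw : Real.log (Real.log w) ≤ θ * Real.log ℓ := by
    calc Real.log (Real.log w) ≤ Real.log (ℓ ^ θ) := Real.log_le_log hlogw_pos hlogw_le
      _ = θ * Real.log ℓ := Real.log_rpow hℓ0 θ
  have hz3 : 3 ≤ z := hw3.trans hwz
  have hlogz_pos : 0 < Real.log z := Real.log_pos (by linarith)
  -- the transfer inequality on the tail `(w, z]`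
  have htrans := twistDist_tail_le_two_mul_add hgb hwz t t₁
  set A := (pretentiousDistSq g (fun n : ℕ => (n : ℂ) ^ ((t : ℂ) * I)) z -
      pretentiousDistSq g (fun n : ℕ => (n : ℂ) ^ ((t : ℂ) * I)) w) +
    (pretentiousDistSq g (fun n : ℕ => (n : ℂ) ^ ((t₁ : ℂ) * I)) z -
      pretentiousDistSq g (fun n : ℕ => (n : ℂ) ^ ((t₁ : ℂ) * I)) w) with hA
  set τ : ℝ := t - t₁ with hτ
  rcases le_or_gt 1 |τ| with hbig | hsmallτ
  · -- `|t - t₁| ≥ 1`: Vinogradov–Korobov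
    have hV := hVKX τ hbig htX z hz hzX
    have hmin : min (Real.log (|τ| * Real.log z)) (Real.log (Real.log z) - θ * Real.log ℓ) ≤
        Real.log (Real.log z) - θ * Real.log ℓ := min_le_right _ _
    linarith
  · -- `|t - t₁| < 1`: the pole of `ζ`
    have hS := hsmall w z hw0 hwz τ hsmallτ.le
    rcases le_or_gt (Real.log (|τ| * Real.log w)) 0 with hneg | hpos
    · rw [max_eq_left hneg] at hS
      have hmin : min (Real.log (|τ| * Real.log z)) (Real.log (Real.log z) - θ * Real.log ℓ) ≤
          Real.log (|τ| * Real.log z) := min_le_left _ _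
      linarith
    · rw [max_eq_right hpos.le] at hS
      -- here `|τ| log w > 1`, so `τ ≠ 0` and `log(|τ| log z) - log(|τ| log w) = log log z - log log w`
      have hτ0 : 0 < |τ| := by
        rcases eq_or_ne τ 0 with h | h
        · rw [h, abs_zero, zero_mul, Real.log_zero] at hpos; linarith
        · exact abs_pos.mpr h
      have h1 : Real.log (|τ| * Real.log z) = Real.log |τ| + Real.log (Real.log z) :=
        Real.log_mul hτ0.ne' hlogz_pos.ne'
      have h2 : Real.log (|τ| * Real.log w) = Real.log |τ| + Real.log (Real.log w) :=
        Real.log_mul hτ0.ne' hlogw_pos.ne'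
      have hmin : min (Real.log (|τ| * Real.log z)) (Real.log (Real.log z) - θ * Real.log ℓ) ≤
          Real.log (Real.log z) - θ * Real.log ℓ := min_le_right _ _
      linarith

/-! ### Block freezing: the damped block distances move little with the twist and the damping -/

/-- `|e^a - e^b| ≤ |a - b|` for `a, b ≤ 0`. [folklore] -/
theorem abs_exp_sub_exp_le_of_nonpos {a b : ℝ} (ha : a ≤ 0) (hb : b ≤ 0) :
    |Real.exp a - Real.exp b| ≤ |a - b| := by
  wlog hab : a ≤ b generalizing a b
  · rw [abs_sub_comm, abs_sub_comm a b]
    exact this hb ha (le_of_not_ge hab)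
  rw [abs_of_nonpos (sub_nonpos.mpr (Real.exp_le_exp.mpr hab)), abs_of_nonpos (sub_nonpos.mpr hab)]
  -- `e^b - e^a = e^b (1 - e^{a-b}) ≤ 1 · (b - a)`
  have h1 : Real.exp b ≤ 1 := by rw [← Real.exp_zero]; exact Real.exp_le_exp.mpr hb
  have h2 : 1 - Real.exp (a - b) ≤ b - a := by
    have := Real.add_one_le_exp (a - b)
    linarith
  have h3 : 0 ≤ 1 - Real.exp (a - b) := by
    rw [sub_nonneg, ← Real.exp_zero]; exact Real.exp_le_exp.mpr (by linarith)
  have h4 : Real.exp b - Real.exp a = Real.exp b * (1 - Real.exp (a - b)) := by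
    rw [mul_sub, mul_one, ← Real.exp_add]; ring_nf
  calc -(Real.exp a - Real.exp b) = Real.exp b - Real.exp a := by ring
    _ = Real.exp b * (1 - Real.exp (a - b)) := h4
    _ ≤ 1 * (b - a) := mul_le_mul h1 h2 h3 zero_le_one
    _ = -(a - b) := by ring

/-- `|p^{-α} - p^{-α'}| ≤ |α - α'| log p` for `p ≥ 1`, `α, α' ≥ 0`. [folklore] -/
theorem abs_rpow_neg_sub_rpow_neg_le {p : ℝ} (hp : 1 ≤ p) {α α' : ℝ} (hα : 0 ≤ α) (hα' : 0 ≤ α') :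
    |p ^ (-α) - p ^ (-α')| ≤ |α - α'| * Real.log p := by
  have hp0 : 0 < p := by linarith
  have hlog : 0 ≤ Real.log p := Real.log_nonneg hp
  rw [Real.rpow_def_of_pos hp0, Real.rpow_def_of_pos hp0]
  refine (abs_exp_sub_exp_le_of_nonpos ?_ ?_).trans (le_of_eq ?_)
  · have := mul_nonneg hlog hα; linarith
  · have := mul_nonneg hlog hα'; linarith
  · rw [show Real.log p * -α - Real.log p * -α' = -(α - α') * Real.log p by ring, abs_mul, abs_neg,
      abs_of_nonneg hlog]

/-- `‖p^{iy} - p^{iy'}‖ ≤ |y - y'| log p` for `p ≥ 1` (chord ≤ arc). [folklore] -/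
theorem norm_cpow_twist_sub_le {p : ℕ} (hp : 1 ≤ p) (y y' : ℝ) :
    ‖(p : ℂ) ^ ((y : ℂ) * I) - (p : ℂ) ^ ((y' : ℂ) * I)‖ ≤ |y - y'| * Real.log p := by
  have hp0 : 0 < p := hp
  have hpC : (p : ℂ) ≠ 0 := by exact_mod_cast hp0.ne'
  have hlogC : Complex.log (p : ℂ) = ((Real.log p : ℝ) : ℂ) := by
    rw [← Complex.ofReal_natCast, ← Complex.ofReal_log (Nat.cast_nonneg p)]
  have hlog : 0 ≤ Real.log p := Real.log_nonneg (by exact_mod_cast hp)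
  have he : ∀ u : ℝ, (p : ℂ) ^ ((u : ℂ) * I) = Complex.exp (I * ((u * Real.log p : ℝ) : ℂ)) := by
    intro u
    rw [Complex.cpow_def_of_ne_zero hpC, hlogC]
    congr 1; push_cast; ring
  rw [he y, he y']
  have hfac : Complex.exp (I * ((y * Real.log p : ℝ) : ℂ)) - Complex.exp (I * ((y' * Real.log p : ℝ) : ℂ)) =
      Complex.exp (I * ((y' * Real.log p : ℝ) : ℂ)) *
        (Complex.exp (I * (((y - y') * Real.log p : ℝ) : ℂ)) - 1) := by
    rw [mul_sub, mul_one, ← Complex.exp_add]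
    congr 2; push_cast; ring
  rw [hfac, norm_mul, Complex.norm_exp_I_mul_ofReal, one_mul]
  refine (Real.norm_exp_I_mul_ofReal_sub_one_le).trans (le_of_eq ?_)
  rw [Real.norm_eq_abs, abs_mul, abs_of_nonneg hlog]

/-- The damped distance summand `p^{-α}(1 - Re(g(p) conj p^{iy}))/p` moves by at most
`(2|α - α'| + |y - y'|) log p / p` when `(α, y)` is replaced by `(α', y')` (`|g| ≤ 1`, `α, α' ≥ 0`, `p ≥ 1`). [folklore] -/
theorem abs_dampedSummand_sub_le {g : ℕ → ℂ} (hgb : ∀ n, ‖g n‖ ≤ 1) {p : ℕ} (hp : 1 ≤ p)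
    {α α' : ℝ} (hα : 0 ≤ α) (hα' : 0 ≤ α') (y y' : ℝ) :
    |(p : ℝ) ^ (-α) * (1 - (g p * conj ((p : ℂ) ^ ((y : ℂ) * I))).re) / p -
        (p : ℝ) ^ (-α') * (1 - (g p * conj ((p : ℂ) ^ ((y' : ℂ) * I))).re) / p| ≤
      (2 * |α - α'| + |y - y'|) * Real.log p / p := by
  have hp1 : (1 : ℝ) ≤ p := by exact_mod_cast hp
  have hp0 : (0 : ℝ) < p := by linarith
  set u : ℂ := (p : ℂ) ^ ((y : ℂ) * I) with hu
  set v : ℂ := (p : ℂ) ^ ((y' : ℂ) * I) with hv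
  set A : ℝ := 1 - (g p * conj u).re with hA
  set B : ℝ := 1 - (g p * conj v).re with hB
  have hu1 : ‖u‖ ≤ 1 := Halasz.Restricted.norm_natCast_cpow_le_one_of_re_eq_zero (by simp) p
  have hv1 : ‖v‖ ≤ 1 := Halasz.Restricted.norm_natCast_cpow_le_one_of_re_eq_zero (by simp) p
  -- `0 ≤ A ≤ 2`, `|A - B| ≤ ‖u - v‖`
  have hre : |(g p * conj u).re| ≤ 1 := by
    have h1 : |(g p * conj u).re| ≤ ‖g p * conj u‖ := Complex.abs_re_le_norm _
    have h2 : ‖g p * conj u‖ ≤ 1 := by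
      rw [norm_mul, Complex.norm_conj]
      calc ‖g p‖ * ‖u‖ ≤ 1 * 1 := mul_le_mul (hgb p) hu1 (norm_nonneg _) zero_le_one
        _ = 1 := one_mul 1
    exact h1.trans h2
  have hAnn : 0 ≤ A := by have := (abs_le.1 hre).2; rw [hA]; linarith
  have hAle : A ≤ 2 := by have := (abs_le.1 hre).1; rw [hA]; linarith
  have hAB : |A - B| ≤ ‖u - v‖ := by
    have h1 : A - B = -((g p * (conj u - conj v)).re) := by
      rw [hA, hB, mul_sub, Complex.sub_re]; ring
    rw [h1, abs_neg]
    calc |(g p * (conj u - conj v)).re| ≤ ‖g p * (conj u - conj v)‖ := Complex.abs_re_le_norm _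
      _ = ‖g p‖ * ‖u - v‖ := by rw [norm_mul, ← map_sub, Complex.norm_conj]
      _ ≤ 1 * ‖u - v‖ := mul_le_mul_of_nonneg_right (hgb p) (norm_nonneg _)
      _ = ‖u - v‖ := one_mul _
  have huv : ‖u - v‖ ≤ |y - y'| * Real.log p := norm_cpow_twist_sub_le hp y y'
  have hpow : |(p : ℝ) ^ (-α) - (p : ℝ) ^ (-α')| ≤ |α - α'| * Real.log p :=
    abs_rpow_neg_sub_rpow_neg_le hp1 hα hα'
  have hpow1 : (p : ℝ) ^ (-α') ≤ 1 := Real.rpow_le_one_of_one_le_of_nonpos hp1 (by linarith)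
  have hpow0 : 0 ≤ (p : ℝ) ^ (-α') := Real.rpow_nonneg hp0.le _
  -- combine: `a A - a' B = (a - a') A + a' (A - B)`
  have hmain : |(p : ℝ) ^ (-α) * A - (p : ℝ) ^ (-α') * B| ≤ (2 * |α - α'| + |y - y'|) * Real.log p := by
    have hsplit : (p : ℝ) ^ (-α) * A - (p : ℝ) ^ (-α') * B =
        ((p : ℝ) ^ (-α) - (p : ℝ) ^ (-α')) * A + (p : ℝ) ^ (-α') * (A - B) := by ring
    rw [hsplit]
    calc |((p : ℝ) ^ (-α) - (p : ℝ) ^ (-α')) * A + (p : ℝ) ^ (-α') * (A - B)|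
        ≤ |((p : ℝ) ^ (-α) - (p : ℝ) ^ (-α')) * A| + |(p : ℝ) ^ (-α') * (A - B)| := abs_add_le _ _
      _ = |(p : ℝ) ^ (-α) - (p : ℝ) ^ (-α')| * A + (p : ℝ) ^ (-α') * |A - B| := by
          rw [abs_mul, abs_mul, abs_of_nonneg hAnn, abs_of_nonneg hpow0]
      _ ≤ (|α - α'| * Real.log p) * 2 + 1 * (|y - y'| * Real.log p) := by
          gcongr
          exact hAB.trans huv
      _ = (2 * |α - α'| + |y - y'|) * Real.log p := by ring
  rw [← sub_div, abs_div, abs_of_pos hp0]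
  exact div_le_div_of_nonneg_right hmain hp0.le

/-- **Block freezing**: over a finite set `E` of primes, the damped distance
`∑_{p ∈ E} p^{-α}(1 - Re(g(p) conj p^{iy}))/p` changes by at most `(2|α - α'| + |y - y'|) ∑_{p ∈ E} log p/p`
when `(α, y) ↦ (α', y')` (`|g| ≤ 1`, `α, α' ≥ 0`).  In the restricted Halász theorem the blocks lie below
`exp(√log x)`, so `∑_{p ∈ E} log p/p ≤ 2√log x` and twists within `e^{O(M)}/log x` of each other see the
same block configuration up to `O(1)`. [folklore] -/
theorem abs_sum_dampedDist_sub_le {g : ℕ → ℂ} (hgb : ∀ n, ‖g n‖ ≤ 1) {E : Finset ℕ}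
    (hE : ∀ p ∈ E, 1 ≤ p) {α α' : ℝ} (hα : 0 ≤ α) (hα' : 0 ≤ α') (y y' : ℝ) :
    |∑ p ∈ E, (p : ℝ) ^ (-α) * (1 - (g p * conj ((p : ℂ) ^ ((y : ℂ) * I))).re) / p -
        ∑ p ∈ E, (p : ℝ) ^ (-α') * (1 - (g p * conj ((p : ℂ) ^ ((y' : ℂ) * I))).re) / p| ≤
      (2 * |α - α'| + |y - y'|) * ∑ p ∈ E, Real.log p / p := by
  rw [← Finset.sum_sub_distrib, Finset.mul_sum]
  refine (Finset.abs_sum_le_sum_abs _ _).trans (Finset.sum_le_sum fun p hp => ?_)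
  exact (abs_dampedSummand_sub_le hgb (hE p hp) hα hα' y y').trans_eq (mul_div_assoc _ _ _)

end Halasz.Restricted.Sharp

end Literature.NumberTheory.LFunctions
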